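import Summits.ResolutionOfSingularities.ResolutionOfSingularities.Theorems.EquisingularLiftEquisingularLiftNatDirectionSections
import Literature.AlgebraicGeometry.Modules.FrameTransition
import HarnessLib

/-!
# [OURS · L1 W4.5(b) · EL♮(3)] T-DIRLIFT-UP (L), brick (C3-iv) — generic helpers: rank-one frames differ by a unit, preimages of affine
# neighbourhoods along a closed immersion, and the kernel of `(ψ ≫ ι_Ī)♯`

Crux chain w45b (cell `res-hironaka`, slot W4.5(b)), child crux **EL♮(3)** = stmt-ResolutionOfSingularities-20148, route EquisingularLift; object (L)
(res-L1-w45b-stub-4 g9, skeleton `L/res-L1-w45b-stub-4/DirLiftSkeleton-v3.lean`). Generic lemmas used by `…NatDirLiftChartReduction`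
((C3-iv)) and by (C3-iii). HONEST FRAMING: OURS; NOT a statement of any manuscript; AI-written, weaker than expert review. No `sorry`; standard
axioms; DEF-FREE. `--supports stmt-ResolutionOfSingularities-20148 --as helper`.

* `basisSection_trans_overIso` — basis sections of `e₀ ≫ f` for an isomorphism `f : E|_W ≅ E'|_W` onto ANOTHER module (twin of res-D-pv-051's
  `basisSection_trans_iso` for automorphisms);
* `isUnit_coord_of_frames` — two rank-one frames of the same module differ by a UNIT on any open below both;
* `exists_affineOpen_preimage_le` — along a closed immersion `f`, every open `B ∋ p` contains `f⁻¹W` for an affine `W ∋ f p` inside a given open;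
* `mem_ideal_of_appLE_comp_subschemeι_eq_zero` — for `ψ : Y' ≅ V(Ī)`, a section of an affine `W` killed by `(ψ ≫ ι_Ī)♯` on the whole preimage
  lies in `Ī(W)` (Mathlib `ker_subschemeι_app`).

References (method): R. Hartshorne, *Algebraic Geometry* (1977), II.5; Mathlib `AlgebraicGeometry.IdealSheaf.Subscheme`.
-/

set_option linter.dupNamespace false

noncomputable section

open CategoryTheory CategoryTheory.Limits AlgebraicGeometry TopologicalSpace Topology IsLocalRing Opposite
open Literature.AlgebraicGeometry.Resolution
open Literature.AlgebraicGeometry.Modules Literature.AlgebraicGeometry.Motives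
open Literature.AlgebraicGeometry.Deformation Literature.AlgebraicGeometry.HodgeTheory
open AlgebraicGeometry.Scheme.IdealSheafData

namespace Summit.ResolutionOfSingularities.ResolutionOfSingularities.Cruxes.EquisingularLiftNat.Sections

open Summit.ResolutionOfSingularities.ResolutionOfSingularities.Cruxes.EquisingularLiftNat.P1VB

universe u

/-! ## Helper lemmas -/

/-- Basis sections of a frame followed by an isomorphism onto another module are the images of the basis sections. [folklore] -/
theorem basisSection_trans_overIso {Y : Scheme.{u}} {E E' : Y.Modules} {W : Y.Opens} {I : Type u}
    (e₀ : SheafOfModules.free I ≅ E.over W) (f : E.over W ≅ E'.over W) (i : I) :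
    basisSection (E := E') (e₀ ≪≫ f) i = appLE f.hom (𝟙 W) (basisSection e₀ i) := by
  rw [basisSection, Iso.trans_hom, SheafOfModules.freeHomEquiv_comp_apply, overSectionsEquiv_sectionsMap']
  rfl

/-- **Two rank-one frames differ by a unit**: the coordinate of (the restriction of) the basis section of one rank-one frame in
another rank-one frame is a unit. [folklore] -/
theorem isUnit_coord_of_frames {Y : Scheme.{0}} {M : Y.Modules} {B W W' : Y.Opens}
    (φ : SheafOfModules.free (Fin 1) ≅ M.over W) (φ' : SheafOfModules.free (Fin 1) ≅ M.over W') (k : B ⟶ W) (k' : B ⟶ W') :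
    IsUnit (coord φ k (M.presheaf.map k'.op (basisSection φ' 0)) 0) := by
  classical
  set b := M.presheaf.map k.op (basisSection φ 0) with hb
  set b' := M.presheaf.map k'.op (basisSection φ' 0) with hb'
  have h1 : b' = coord φ k b' 0 • b := by
    have h := eq_sum_coord_smul φ k b'
    rwa [Fin.sum_univ_one] at h
  have h2 : b = coord φ' k' b 0 • b' := by
    have h := eq_sum_coord_smul φ' k' b
    rwa [Fin.sum_univ_one] at h
  have h3 : coord φ k b 0 = 1 := by
    rw [hb, coord_map_basisSection, if_pos rfl]
  have h4 : coord φ' k' b 0 * coord φ k b' 0 = 1 := by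
    have h : coord φ k b 0 = coord φ k (coord φ' k' b 0 • b') 0 := by rw [← h2]
    rw [coord_smul, h1, coord_smul, h3, mul_one] at h
    exact h.symm
  exact IsUnit.of_mul_eq_one_right _ h4

/-- Along a closed immersion `f : Y' → G₀`, every open neighbourhood `B ∋ p` contains the preimage of an affine open neighbourhood of
`f p` inside any given open `W₀ ∋ f p`. [folklore] -/
theorem exists_affineOpen_preimage_le {Y' G₀ : Scheme.{u}} (f : Y' ⟶ G₀) [IsClosedImmersion f] (p : Y') (B : Y'.Opens) (hp : p ∈ B)
    (W₀ : G₀.Opens) (hW₀ : f p ∈ W₀) :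
    ∃ (W : G₀.affineOpens), f p ∈ (W : G₀.Opens) ∧ (W : G₀.Opens) ≤ W₀ ∧ f ⁻¹ᵁ (W : G₀.Opens) ≤ B := by
  obtain ⟨O, hO, hOB⟩ := f.isClosedEmbedding.isInducing.isOpen_iff.mp B.2
  have hpO : f p ∈ O := by
    have : p ∈ f.base ⁻¹' O := by rw [hOB]; exact hp
    exact this
  obtain ⟨W, hW, hpW, hWle⟩ := exists_isAffineOpen_mem_and_subset (U := ⟨O, hO⟩ ⊓ W₀) (x := f p) ⟨hpO, hW₀⟩
  refine ⟨⟨W, hW⟩, hpW, fun _ h => (hWle h).2, fun q hq => ?_⟩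
  have : q ∈ f.base ⁻¹' O := (hWle hq).1
  rw [hOB] at this
  exact this

/-- **Kernel of the comparison with the special fibre of the curve**: for `ψ` an isomorphism onto `V(Ī)`, a section of an affine
`W ⊆ G₀` killed by `(ψ ≫ ι_Ī)♯` on the whole preimage lies in `Ī(W)`. [folklore] -/
theorem mem_ideal_of_appLE_comp_subschemeι_eq_zero {G₀ Y' : Scheme.{u}} (Ī : G₀.IdealSheafData) (ψ : Y' ⟶ Ī.subscheme) [IsIso ψ]
    (W : G₀.affineOpens) {a : Γ(G₀, W)}
    (h : (ψ ≫ Ī.subschemeι).appLE W ((ψ ≫ Ī.subschemeι) ⁻¹ᵁ (W : G₀.Opens)) le_rfl a = 0) : a ∈ Ī.ideal W := by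
  rw [← ker_subschemeι_app Ī W, RingHom.mem_ker]
  rw [Scheme.Hom.appLE_eq_app, Scheme.Hom.comp_app] at h
  change ψ.app _ (Ī.subschemeι.app W a) = 0 at h
  haveI : IsIso (ψ.app (Ī.subschemeι ⁻¹ᵁ (W : G₀.Opens))) := inferInstance
  have hinj : Function.Injective (ψ.app (Ī.subschemeι ⁻¹ᵁ (W : G₀.Opens))) :=
    (ConcreteCategory.bijective_of_isIso (ψ.app (Ī.subschemeι ⁻¹ᵁ (W : G₀.Opens)))).1
  exact hinj (h.trans (map_zero _).symm)

end Summit.ResolutionOfSingularities.ResolutionOfSingularities.Cruxes.EquisingularLiftNat.Sections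

end
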